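import Summits.CriticalPhenomena.PercolationContinuityZ3.Theorems.Transplant.SkelFrmFromBParamsFaceCountsA
import Summits.CriticalPhenomena.PercolationContinuityZ3.Theorems.Transplant.SkelFrmBParamsFaceCountsA
import Summits.CriticalPhenomena.PercolationContinuityZ3.Theorems.Transplant.PlanarSkeletonFrmFromDefs
import Summits.CriticalPhenomena.PercolationContinuityZ3.Theorems.Transplant.PlanarSkeletonFrmDefs
import Summits.CriticalPhenomena.PercolationContinuityZ3.Theorems.Transplant.SkelPhiStepIDataNS
import HarnessLib
import Summits.CriticalPhenomena.PercolationContinuityZ3.Theorems.Transplant.SkelFrmBParamsFaceCountsYA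
/-!
# U-WAVE PORT (RULING D-U, lead g21 2026-08-26; WAVE-U-MANIFEST v3.1 row «SkelFrmBParamsFaceCountsYA» ↦ «SkelFrmFromBParamsFaceCountsYA») of the tree module
# `Transplant/SkelFrmBParamsFaceCountsYA` onto the carrier `PlanarSkeletonFrmFrom` (frames only, cylinders connected from width `ℓ₀` on)

ORIGINAL TITLE: (F) VALUE LAYER, N2 twin (hp-8 g42, 2026-08-23; F-DISCHARGE-MAP-N2 G18 y′-face counts, (Δ1)/(R-22)): `port_frm.py` text of N1 `SkelNegBParamsFaceCountsYA` (hp-8 g36)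

builds on p205010 (kernel theorem, internal audit signed; external expert review pending) — nothing in this file uses p205010; NOTHING is claimed about the
OPEN node U `SamePDropOfSkeletonFrmFrom₁` (nor U_s / the end state).  Lane `prim-bschramm`, seat `prim-bschramm-stmt` gen 26 (port pen, RULING M-11 family P-stmt; tool = p3-g26's port_u.py of record, registry-driven inputs); helper file
(`--supports stmt-CriticalPhenomena-4575 --as helper`).  PORT RULES r1–r4 of RULING D-U: declaration order and proof texts are those of the original,
byte-identical except (i) the carrier token `PlanarSkeletonFrm ↦ PlanarSkeletonFrmFrom` (binders, `namespace`/`end` lines, qualified names of twinned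
declarations), (ii) carrier-FREE declarations of the original (φ-level `Skelφ…` blocks and namespace-only arithmetic residents) are NOT re-declared —
this file imports the original and `export`s the twin-free residents (POLICY T / treatment (m1)); residents whose statement mentions a twinned
constant are copied, (iii) every carrier-binding declaration keeps its explicit binder `(Φ : PlanarSkeletonFrmFrom G)` in its own signature (r2).  Docstrings and citations are the original's.
-/

noncomputable section

open scoped Classical

namespace Summit.CriticalPhenomena.PercolationContinuityZ3.Theorems.Transplant

namespace PlanarSkeletonFrmFrom

namespace NegB

open Literature.Probability.Percolation Literature.Probability.LatticeModels SimpleGraph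
open Literature.Probability.Percolation.KozmaNitzan.Cells (oth sgOf sgOf_sign stepVec_apply_fst stepVec_apply_oth)
open SkelConc (Consts)
open Skelφ.StepI (DataN)
open TwoAxis.Para (modulus)
open Neg

namespace KS

section FaceCountsY

export PlanarSkeletonFrm.NegB.KS (T1Y)

export PlanarSkeletonFrm.NegB.KS (T0Y)

/-- **The along count of the y′-run** `NrY := round(σ·(T1Y − F1cA yL)/u₁) − 1` (clipped at `0`). [this work] -/
def NrY (κ : Consts) {V : Type} [DecidableEq V] [Countable V] {G : SimpleGraph V} [G.LocallyFinite] (Φ : PlanarSkeletonFrmFrom G) (t : V) (p : unitInterval) (D : Skelφ.StepI.DataNS V) (g : ℕ) (f : ℕ) (P : PCells2T) (yL : Site 2) (x : Site 2) (du : MDir) (z : Site 2) : ℕ :=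
  Int.toNat ((sgOf du * (T1Y P x du z - F1cA κ Φ t p D g f yL) + u₁A κ Φ t p D g f / 2) / u₁A κ Φ t p D g f - 1)

/-- **The tangential sign of the x-run**: towards the transverse target from the landing origin's abscissa reading. [this work] -/
def σTY (κ : Consts) {V : Type} [DecidableEq V] [Countable V] {G : SimpleGraph V} [G.LocallyFinite] (Φ : PlanarSkeletonFrmFrom G) (t : V) (p : unitInterval) (D : Skelφ.StepI.DataNS V) (g : ℕ) (f : ℕ) (P : PCells2T) (yL x : Site 2) (du : MDir) (z : Site 2) : ℤ := if FcA κ Φ t p D g f yL ≤ T0Y P x du z then 1 else -1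

/-- **The tangential count of the x-run** `N3Y := round(|T0Y − FcA yL|/u₀) − 1` (clipped at `0`). [this work] -/
def N3Y (κ : Consts) {V : Type} [DecidableEq V] [Countable V] {G : SimpleGraph V} [G.LocallyFinite] (Φ : PlanarSkeletonFrmFrom G) (t : V) (p : unitInterval) (D : Skelφ.StepI.DataNS V) (g : ℕ) (f : ℕ) (P : PCells2T) (yL x : Site 2) (du : MDir) (z : Site 2) : ℕ :=
  Int.toNat ((|T0Y P x du z - FcA κ Φ t p D g f yL| + u₀A κ Φ t p D g f / 2) / u₀A κ Φ t p D g f - 1)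

export PlanarSkeletonFrm.NegB.KS (T1Y_eq)

export PlanarSkeletonFrm.NegB.KS (cenS_step_zero)

/-- **The tangential choice of the x-run is admissible**: `σTY = ±1`; `u₀·(N3Y+1) ≤ |T0Y − FcA yL| + 2u₀`; and the x-run's nominal end reading is
within two strides of the transverse target, `|FcA yL + σTY·u₀·(N3Y+1) − T0Y| ≤ 2u₀`. [folklore] -/
theorem N3Y_spec (κ : Consts) {V : Type} [DecidableEq V] [Countable V] {G : SimpleGraph V} [G.LocallyFinite] (Φ : PlanarSkeletonFrmFrom G) (t : V) (p : unitInterval) (D : Skelφ.StepI.DataNS V) (g : ℕ) (f : ℕ) (P : PCells2T) (yL x : Site 2) (du : MDir) (z : Site 2) :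
    (σTY κ Φ t p D g f P yL x du z = 1 ∨ σTY κ Φ t p D g f P yL x du z = -1) ∧
      u₀A κ Φ t p D g f * ((N3Y κ Φ t p D g f P yL x du z : ℤ) + 1) ≤ |T0Y P x du z - FcA κ Φ t p D g f yL| + 2 * u₀A κ Φ t p D g f ∧
      |FcA κ Φ t p D g f yL + σTY κ Φ t p D g f P yL x du z * u₀A κ Φ t p D g f * ((N3Y κ Φ t p D g f P yL x du z : ℤ) + 1) - T0Y P x du z| ≤ 2 * u₀A κ Φ t p D g f := by
  have hu : 1 ≤ u₀A κ Φ t p D g f := (units_eqA κ Φ t p D g f).2.2.2.2.1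
  set u := u₀A κ Φ t p D g f
  set T := T0Y P x du z
  set F := FcA κ Φ t p D g f yL
  have hσ : σTY κ Φ t p D g f P yL x du z = 1 ∨ σTY κ Φ t p D g f P yL x du z = -1 := by unfold σTY; split_ifs <;> simp
  refine ⟨hσ, ?_⟩
  obtain ⟨d1, d2⟩ := PlanarSkeletonNeg.NegB.RootArith.floor_sandwich (x := u) (d := 2) (by norm_num)
  by_cases hfar : u ≤ |T - F|
  · obtain ⟨r1, r2⟩ := round_count (X := |T - F|) (by linarith) hfar
    have hN : (N3Y κ Φ t p D g f P yL x du z : ℤ) = ((Int.toNat ((|T - F| + u / 2) / u - 1) : ℕ) : ℤ) := rfl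
    rw [hN]
    refine ⟨by linarith, ?_⟩
    set M : ℤ := ((Int.toNat ((|T - F| + u / 2) / u - 1) : ℕ) : ℤ)
    obtain ⟨a1, a2⟩ := abs_le.1 r1
    unfold σTY
    split_ifs with hle
    · rw [abs_of_nonneg (by linarith : (0:ℤ) ≤ T - F)] at a1 a2
      rw [abs_le]; constructor <;> linarith
    · push Not at hle
      rw [abs_of_neg (by linarith : T - F < 0)] at a1 a2
      rw [abs_le]; constructor <;> linarith
  · -- the target is within one stride: the count is `0`
    push Not at hfar
    obtain ⟨x1, x2⟩ := PlanarSkeletonNeg.NegB.RootArith.floor_sandwich (x := |T - F| + u / 2) (d := u) (by linarith)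
    have hY : (|T - F| + u / 2) / u - 1 ≤ 0 := by
      by_contra hc; push Not at hc
      have : u * 2 ≤ u * ((|T - F| + u / 2) / u) := mul_le_mul_of_nonneg_left (by linarith) (by linarith)
      linarith [abs_nonneg (T - F)]
    have hN : (N3Y κ Φ t p D g f P yL x du z : ℤ) = 0 := by
      show ((Int.toNat ((|T - F| + u / 2) / u - 1) : ℕ) : ℤ) = 0
      rw [Int.toNat_of_nonpos hY]; rfl
    rw [hN, zero_add, mul_one]
    refine ⟨by linarith [abs_nonneg (T - F)], ?_⟩
    have hab := abs_le.1 (le_of_lt hfar)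
    rcases hσ with h | h <;> rw [h] <;> rw [abs_le] <;> constructor <;> linarith

/-- **The along choice of the y′-run is admissible** (target at least one region ahead of the landing origin): the run's nominal end reading is
within one region of the along target and the count is bounded by the distance. [cite: KozmaNitzan2024, §4 Lemma 11 (p. 22)] -/
theorem NrY_spec (κ : Consts) {V : Type} [DecidableEq V] [Countable V] {G : SimpleGraph V} [G.LocallyFinite] (Φ : PlanarSkeletonFrmFrom G) (t : V) (p : unitInterval) (D : Skelφ.StepI.DataNS V) (g : ℕ) (f : ℕ) (P : PCells2T) (yL : Site 2) (x : Site 2) (du : MDir) (z : Site 2)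
    (hX : u₁A κ Φ t p D g f ≤ sgOf du * (T1Y P x du z - F1cA κ Φ t p D g f yL)) :
    |F1cA κ Φ t p D g f yL + sgOf du * u₁A κ Φ t p D g f * ((NrY κ Φ t p D g f P yL x du z : ℤ) + 1) - T1Y P x du z| ≤ u₁A κ Φ t p D g f ∧
      u₁A κ Φ t p D g f * ((NrY κ Φ t p D g f P yL x du z : ℤ) + 1) ≤ sgOf du * (T1Y P x du z - F1cA κ Φ t p D g f yL) + u₁A κ Φ t p D g f := by
  have hu : 1 ≤ u₁A κ Φ t p D g f := (units_eqA κ Φ t p D g f).2.2.2.2.2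
  have hσ : sgOf du = 1 ∨ sgOf du = -1 := sgOf_sign du
  set u := u₁A κ Φ t p D g f
  set T := T1Y P x du z
  set F := F1cA κ Φ t p D g f yL
  obtain ⟨r1, r2⟩ := round_count (X := sgOf du * (T - F)) (by linarith) hX
  have hNr : (NrY κ Φ t p D g f P yL x du z : ℤ) = ((Int.toNat ((sgOf du * (T - F) + u / 2) / u - 1) : ℕ) : ℤ) := rfl
  rw [hNr]
  refine ⟨?_, r2⟩
  set M : ℤ := ((Int.toNat ((sgOf du * (T - F) + u / 2) / u - 1) : ℕ) : ℤ)
  obtain ⟨a1, a2⟩ := abs_le.1 r1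
  rcases hσ with h | h <;> rw [h] at a1 a2 ⊢ <;> rw [abs_le] <;> constructor <;> linarith

end FaceCountsY

end KS

end NegB

end PlanarSkeletonFrmFrom

end Summit.CriticalPhenomena.PercolationContinuityZ3.Theorems.Transplant

end
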